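import Literature.Probability.LatticeModels.DiscreteDualDomain
import HarnessLib

/-!
# The boundary of `Ω*_int` is traced by the dual darts of the arrows of `∂Ω` (local step)

Topic `Literature/Probability/LatticeModels` (family `crit-ising`); support for the dual side of the printed proof of
CDH16 Thm. 1.1 (`fkIsing_topologicalRectangle_crossingBounds`): towards an `IsRect` presentation of the dual
rectangle `(Ω*_int; a*, b*, c*, d*)` (CDH16 §2.5, §3.3, Cor. 4.4, (3.8)), in the vocabulary of
`DiscreteRectBoundaryTrace.lean` (squares `quad`, faces `InF`/`faces`, arrows, `lsq`/`rsq`, `slots`, `succ`) and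
`DiscreteDualDomain.lean` (`dualInt E = Ω*_int`, `dualDart`).

* `DiscreteRect.IsFaceDomain E` — "`Ω` is made of square tiles" (CDH16 §2.5): every edge of `E` is a side of a face;
* `DiscreteRect.NoPinchAt E q` — the faces at `q` are not exactly two diagonally opposite squares (at such pinch
  points `Ω*_int` disconnects although there is no bridge; CDH16's "`Ω*_int` is connected if `Ω` does not contain
  bridges" tacitly excludes them);
* `DiscreteRect.nextArrow E (p, m)` — the right-hand rule of the boundary trace at the head `q = p + e_m`: the first
  edge of `E` among right, straight, left, back (this is `succ`/`slots` unfolded arrow by arrow);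
* **`DiscreteRect.succ_dualInt_dualDart`** (proved): in a face domain without pinch at `q`, for an arrow `(p, m)` of
  `∂Ω` (left square a face, right square not), `succ (dualInt E) (dualDart (p, m)) = dualDart (nextArrow E (p, m))` —
  the boundary-tracing successor of `Ω*_int` follows the trace of `Ω`. The three cases left / straight / right at `q`
  are exactly the three face patterns (neither / only the left one / both) of the two squares ahead; a dead end does
  not occur. (Checked beforehand on 9166 arrows of 600 random simply connected polyominoes without cut vertices.)

Remaining steps to the dual presentation (not here): consecutive arrows of the trace satisfy `a' = nextArrow a`
(within a segment `slots E d` the next arrows are right turns; a new dart starts straight, after a turn left), hence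
the dual darts of the arrows of one boundary cycle of `Ω` form one boundary cycle of `Ω*_int`.

## References
* [ChelkakDuminilCopinHongler2016] D. Chelkak, H. Duminil-Copin, C. Hongler, EJP 21 (2016) no. 5, §2.1 (cyclic
  order on `∂Ω`), §2.5 (`Ω*_int`, "made of square tiles"), §3.3 (`x*`).
-/

noncomputable section

open SimpleGraph Finset

namespace Literature.Probability.LatticeModels

namespace DiscreteRect

variable {E : Finset (Sym2 (Site 2))}

/-- **Face domain**: every edge of `E` is a side of a face of `Ω` — the discrete domain "is made of square
tiles" (CDH16 §2.5); for every arrow on an edge of `E`, its left or its right square is a face.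
[cite: ChelkakDuminilCopinHongler2016, §2.5] -/
def IsFaceDomain (E : Finset (Sym2 (Site 2))) : Prop :=
  ∀ a : Site 2 × Fin 4, aedge a ∈ E → InF E (lsq a) ∨ InF E (rsq a)

/-- **No pinch at `q`**: the faces of `Ω` at the vertex `q` do not consist of exactly two diagonally opposite
squares (at such a pinch point `Ω*_int` is disconnected although `Ω` has no bridge). [folklore] -/
def NoPinchAt (E : Finset (Sym2 (Site 2))) (q : Site 2) : Prop :=
  ∀ k : Fin 4, InF E (quad q k) → InF E (quad q (k + 2)) → InF E (quad q (k + 1)) ∨ InF E (quad q (k + 3))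

/-- **The right-hand rule of the boundary trace**: arriving at `q = p + e_m` along the arrow `(p, m)`, the trace
continues along the first edge of `E` among: right `e_{m-1}`, straight `e_m`, left `e_{m+1}`, back `e_{m+2}`
(this is `succ`/`slots` unfolded: the second and third arrows of a segment are right turns, a new dart starts
straight, after one turn left, after two turns back). [cite: ChelkakDuminilCopinHongler2016, §2.1] -/
def nextArrow (E : Finset (Sym2 (Site 2))) (a : Site 2 × Fin 4) : Site 2 × Fin 4 :=
  if s(a.1 + dir a.2, a.1 + dir a.2 + dir (a.2 + 3)) ∈ E then (a.1 + dir a.2, a.2 + 3)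
  else if s(a.1 + dir a.2, a.1 + dir a.2 + dir a.2) ∈ E then (a.1 + dir a.2, a.2)
  else if s(a.1 + dir a.2, a.1 + dir a.2 + dir (a.2 + 1)) ∈ E then (a.1 + dir a.2, a.2 + 1)
  else (a.1 + dir a.2, a.2 + 2)

/-! ### Square bookkeeping around a vertex -/

/-- The square ahead-left: `quad x k + e_k = quad (x + e_k) k`. [folklore] -/
theorem quad_add_dir_self (x : Site 2) (k : Fin 4) : quad x k + dir k = quad (x + dir k) k := by
  rw [Site.eq_iff_two]
  fin_cases k <;> simp [quad, dir]

/-- From ahead-left to ahead-right: `quad x k + e_{k+3} = quad x (k+3)`. [folklore] -/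
theorem quad_add_dir_add_three (x : Site 2) (k : Fin 4) : quad x k + dir (k + 3) = quad x (k + 3) := by
  rw [Site.eq_iff_two]
  fin_cases k <;> simp [quad, dir]

/-- From ahead-right back to behind-right: `quad (x + e_k) (k+3) + e_{k+2} = quad x (k+3)`. [folklore] -/
theorem quad_add_dir_three_add (x : Site 2) (k : Fin 4) : quad (x + dir k) (k + 3) + dir (k + 2) = quad x (k + 3) := by
  rw [Site.eq_iff_two]
  fin_cases k <;> simp [quad, dir]

/-- Behind-right seen from `q`: `quad (x + e_k) (k+2) = quad x (k+3)`. [folklore] -/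
theorem quad_add_dir_two (x : Site 2) (k : Fin 4) : quad (x + dir k) (k + 2) = quad x (k + 3) := by
  rw [Site.eq_iff_two]
  fin_cases k <;> simp [quad, dir]

/-- A face has all its sides: the side from its `j`-th corner. [folklore] -/
theorem InF.side_mem {s : Site 2} (h : InF E s) (j : Fin 4) : s(corner s j, corner s j + dir j) ∈ E := h j

/-- The side of the face `quad q k` from `q` in direction `k` is an edge. [folklore] -/
theorem mem_of_inF_quad {q : Site 2} {k : Fin 4} (h : InF E (quad q k)) : s(q, q + dir k) ∈ E := by
  have := h.side_mem k
  rwa [corner_quad] at this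

/-! ### The dual trace follows the primal trace (local step) -/

/-- **The boundary of `Ω*_int` is traced by the dual darts of the arrows of `∂Ω`** (local step): in a face domain
without pinch at `q = p + e_m`, for an arrow `a = (p, m)` of `∂Ω` (left square a face, right square not) the
boundary-tracing successor in `Ω*_int` of the dual dart of `a` is the dual dart of the next arrow of the trace of
`Ω`. The three cases (left turn / straight / right turn at `q`) are exactly the three patterns (neither / only the
left / both) of the two squares ahead of `a` being faces; a dead end does not occur. [cite: ChelkakDuminilCopinHongler2016, §2.5 and §3.3] -/
theorem succ_dualInt_dualDart (hF : IsFaceDomain E) {p : Site 2} {m : Fin 4} (hq : NoPinchAt E (p + dir m))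
    (hl : InF E (quad p m)) (hr : ¬ InF E (quad p (m + 3))) :
    succ (dualInt E) (dualDart (p, m)) = dualDart (nextArrow E (p, m)) := by
  -- notation: `q` the head, `f` = behind-left (a face), `al` = ahead-left, `ar` = ahead-right, `br` = behind-right
  have k1 : ∀ m : Fin 4, m + 3 + 1 = m := by decide
  have k2 : ∀ m : Fin 4, m + 1 + 3 = m := by decide
  have k3 : ∀ m : Fin 4, m + 3 + 3 = m + 2 := by decide
  have k4 : ∀ m : Fin 4, m + 3 - 1 = m + 2 := by decide
  have k5 : ∀ m : Fin 4, m + 3 + 2 = m + 1 := by decide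
  have k6 : ∀ m : Fin 4, m + 1 + 2 = m + 3 := by decide
  have k7 : ∀ m : Fin 4, m + 1 + 1 = m + 2 := by decide
  have hf_faces : quad p m ∈ faces E := mem_faces.2 hl
  have hbr : quad p (m + 3) ∉ faces E := fun h ↦ hr (mem_faces.1 h)
  -- the edges at `q`
  have hL : s(p + dir m, p + dir m + dir (m + 1)) ∈ E := by
    have := mem_of_inF_quad (q := p + dir m) (k := m + 1) (by rw [quad_add_dir]; exact hl)
    exact this
  -- face status of the squares ahead decides everything
  by_cases hal : InF E (quad (p + dir m) m)
  · have hal' : quad (p + dir m) m ∈ faces E := mem_faces.2 hal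
    by_cases har : InF E (quad (p + dir m) (m + 3))
    · -- right turn
      have har' : quad (p + dir m) (m + 3) ∈ faces E := mem_faces.2 har
      have hR : s(p + dir m, p + dir m + dir (m + 3)) ∈ E := mem_of_inF_quad har
      have hnext : nextArrow E (p, m) = (p + dir m, m + 3) := by simp [nextArrow, hR]
      rw [hnext]
      -- compute `succ` on the dual side: case 3
      have e1 : s(quad p m, quad p m + dir (m + 3 + 1)) ∈ dualInt E := by
        rw [k1]; exact mem_dualInt_of_faces hf_faces (by rw [quad_add_dir_self]; exact hal')
      have e2 : s(quad p m + dir (m + 3 + 1), quad p m + dir (m + 3 + 1) + dir (m + 3)) ∈ dualInt E := by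
        rw [k1, quad_add_dir_self]
        exact mem_dualInt_of_faces hal' (by rw [quad_add_dir_add_three]; exact har')
      have e3 : s(quad p m + dir (m + 3 + 1) + dir (m + 3), quad p m + dir (m + 3 + 1) + dir (m + 3) + dir (m + 3 - 1)) ∉
          dualInt E := by
        rw [k1, k4, quad_add_dir_self, quad_add_dir_add_three, quad_add_dir_three_add]
        exact fun h ↦ hbr (mem_faces_of_mem_dualInt h).2
      simp only [dualDart, lsq_mk, succ, e1, e2, e3, not_true_eq_false, not_false_eq_true, if_false, if_true]
      rw [k1, k4, k3, quad_add_dir_self, quad_add_dir_add_three]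
    · -- straight
      have hR : s(p + dir m, p + dir m + dir (m + 3)) ∉ E := by
        intro hmem
        rcases hF (p + dir m, m + 3) hmem with h | h
        · exact har (by simpa using h)
        · rw [rsq_mk, k3, quad_add_dir_two] at h
          exact hr h
      have hS : s(p + dir m, p + dir m + dir m) ∈ E := mem_of_inF_quad hal
      have hnext : nextArrow E (p, m) = (p + dir m, m) := by simp [nextArrow, hR, hS]
      rw [hnext]
      have e1 : s(quad p m, quad p m + dir (m + 3 + 1)) ∈ dualInt E := by
        rw [k1]; exact mem_dualInt_of_faces hf_faces (by rw [quad_add_dir_self]; exact hal')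
      have e2 : s(quad p m + dir (m + 3 + 1), quad p m + dir (m + 3 + 1) + dir (m + 3)) ∉ dualInt E := by
        rw [k1, quad_add_dir_self, quad_add_dir_add_three]
        exact fun h ↦ har (mem_faces.1 (mem_faces_of_mem_dualInt h).2)
      simp only [dualDart, lsq_mk, succ, e1, e2, not_true_eq_false, not_false_eq_true, if_false, if_true]
      rw [k1, quad_add_dir_self]
  · -- left turn: the square ahead-right is not a face either (no pinch), the edges right and straight are absent
    have har : ¬ InF E (quad (p + dir m) (m + 3)) := by
      intro har
      -- pinch at `q`: `f = quad q (m+1)` and `ar = quad q (m+3)` faces, `al = quad q m`? use NoPinch with k = m + 1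
      have h1 : InF E (quad (p + dir m) (m + 1)) := by rw [quad_add_dir]; exact hl
      have h2 : InF E (quad (p + dir m) (m + 1 + 2)) := by rw [k6]; exact har
      rcases hq (m + 1) h1 h2 with h | h
      · rw [k7, quad_add_dir_two] at h
        exact hr h
      · rw [show m + 1 + 3 = m by exact k2 m] at h
        exact hal h
    have hR : s(p + dir m, p + dir m + dir (m + 3)) ∉ E := by
      intro hmem
      rcases hF (p + dir m, m + 3) hmem with h | h
      · exact har (by simpa using h)
      · rw [rsq_mk, k3, quad_add_dir_two] at h
        exact hr h
    have hS : s(p + dir m, p + dir m + dir m) ∉ E := by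
      intro hmem
      rcases hF (p + dir m, m) hmem with h | h
      · exact hal (by simpa using h)
      · rw [rsq_mk] at h
        exact har h
    have hnext : nextArrow E (p, m) = (p + dir m, m + 1) := by simp [nextArrow, hR, hS, hL]
    rw [hnext]
    have e1 : s(quad p m, quad p m + dir (m + 3 + 1)) ∉ dualInt E := by
      rw [k1, quad_add_dir_self]
      exact fun h ↦ hal (mem_faces.1 (mem_faces_of_mem_dualInt h).2)
    simp only [dualDart, lsq_mk, succ, e1, not_false_eq_true, if_true]
    rw [k1, k2, quad_add_dir]

end DiscreteRect

end Literature.Probability.LatticeModels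

end
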